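import Summits.SmoothPoincare4.SmoothPoincare4.Theorems.CongruenceShadowsGriffithsHandlebodyExtensionCoverPlanarE
import HarnessLib

/-!
# SmoothPoincare4 / CongruenceShadows — `GriffithsHandlebodyExtension` (item stmt-SmoothPoincare4-15190): the planar family (E3), C.2 — the correction family and Smale in families

Support file (`--supports` stmt-SmoothPoincare4-15190) of the homothety-cover proof of the genus-one
clause (E) of Griffiths' handlebody extension theorem — *every self-diffeomorphism of the Heegaard torus
`∂V` of the round solid torus fixing the base point and acting trivially on `π₁(∂V)` extends to a
self-diffeomorphism of `V`* (hypothesis `hE` of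
`Literature.Topology.FourManifolds.RoundSolidTorusModel.diffeoExtends_of_map_ker_eq_ker_of_forall_diffeoExtends`).
See the module docstring of `…CoverDefs` for the whole line (E1–E6) and the notation
(`τ̂`, `δ_λ`, `ρ`, `χ`, `f`, `Δ^(c)`, `α`, `L`, `M`, `Ψ̂`, `ẽ_c`).

This part (E3-C, second third): the correction family `H_u = e₀⁻¹ ∘ h_{cl u} ∘ e₀` on the open unit disc (identity near
the circle, jointly smooth, with inverse `H'`), Smale's theorem in families applied to it (`CD.exists_K`, via
`exists_ball_diffeotopy_family_of_linearIsometryEquiv`), and the closing path `k_t`.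
-/

-- the registered namespace `Summit.SmoothPoincare4.SmoothPoincare4.Theorems` repeats a component
set_option linter.dupNamespace false

noncomputable section

namespace Summit.SmoothPoincare4.SmoothPoincare4.Theorems

namespace HomothetyCover

open Set Function Metric Filter
open scoped Topology ContDiff

namespace Planar

open Set Function Metric Filter
open scoped Topology ContDiff Manifold
open Literature.Topology.FourManifolds
attribute [local instance] factFinrankE2
variable {lam : ℝ} (P : PI lam)

section ClosingData

variable {lam : ℝ} {P : PI lam}

namespace PI

namespace CD

variable (D : CD P)

/-! #### The correction family `H_u` -/

/-- `H u z = e₀⁻¹ (h_{cl u} (e₀ z))` on the open unit disc, the identity outside. -/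
def H (u : ℝ) (z : E2) : E2 := if ‖z‖ < 1 then D.e₀' (D.hmap (tclamp u) (D.e₀ z)) else z

/-- Its inverse. -/
def H' (u : ℝ) (z : E2) : E2 := if ‖z‖ < 1 then D.e₀' (D.hmap' (tclamp u) (D.e₀ z)) else z

/-- The tclamp takes values in `(0, 2)`. -/
theorem tclamp_mem_Ioo (u : ℝ) : tclamp u ∈ Ioo (0 : ℝ) 2 :=
  ⟨by linarith [(tclamp_mem u).1], by linarith [(tclamp_mem u).2]⟩

/-- For `‖z‖ < 1`, `h (e₀ z) = e₀ x` with `‖x‖ < 1`. -/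
theorem exists_hmap_e₀ (hlam : 1 < lam) (u : ℝ) {z : E2} (hz : ‖z‖ < 1) :
    ∃ x : E2, ‖x‖ < 1 ∧ D.hmap (tclamp u) (D.e₀ z) = D.e₀ x := by
  have : D.hmap (tclamp u) (D.e₀ z) ∈ D.hmap (tclamp u) '' {w | ‖P.τ' w‖ < 1} := by
    refine mem_image_of_mem _ ?_
    rw [← D.img_ball]; exact mem_image_of_mem _ (mem_ball_zero_iff.2 hz)
  rw [D.hmap_image_Tint hlam (tclamp_mem_Ioo u), ← D.img_ball] at this
  obtain ⟨x, hx, hxe⟩ := this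
  exact ⟨x, mem_ball_zero_iff.1 hx, hxe.symm⟩

/-- For `‖z‖ < 1`, `h'_{cl u} (e₀ z) = e₀ x` with `‖x‖ < 1`. -/
theorem exists_hmap'_e₀ (hlam : 1 < lam) (u : ℝ) {z : E2} (hz : ‖z‖ < 1) :
    ∃ x : E2, ‖x‖ < 1 ∧ D.hmap' (tclamp u) (D.e₀ z) = D.e₀ x := by
  have himg : D.hmap' (tclamp u) '' {w | ‖P.τ' w‖ < 1} = {w | ‖P.τ' w‖ < 1} := by
    have h := D.hmap_image_Tint hlam (tclamp_mem_Ioo u)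
    have hinv : D.hmap' (tclamp u) '' (D.hmap (tclamp u) '' {w : E2 | ‖P.τ' w‖ < 1}) = {w | ‖P.τ' w‖ < 1} := by
      rw [← image_comp]; convert image_id _; funext w; exact D.hmap'_hmap _ w
    rw [h] at hinv; exact hinv
  have : D.hmap' (tclamp u) (D.e₀ z) ∈ D.hmap' (tclamp u) '' {w | ‖P.τ' w‖ < 1} := by
    refine mem_image_of_mem _ ?_
    rw [← D.img_ball]; exact mem_image_of_mem _ (mem_ball_zero_iff.2 hz)
  rw [himg, ← D.img_ball] at this
  obtain ⟨x, hx, hxe⟩ := this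
  exact ⟨x, mem_ball_zero_iff.1 hx, hxe.symm⟩

/-- On the collar `1 - η < ‖z‖` the monodromy fixes `e₀ z`. -/
theorem hmap_e₀_collar (hlam : 1 < lam) (u : ℝ) {z : E2} (hz1 : 1 - D.η < ‖z‖) (hz2 : ‖z‖ < 1 + D.η) :
    D.hmap (tclamp u) (D.e₀ z) = D.e₀ z := by
  have hl : 0 < lam := lt_trans zero_lt_one hlam
  have hc : |‖z‖ - 1| < D.η := by rw [abs_lt]; constructor <;> linarith
  have hmem : P.τ' (D.e₀ z) ∈ ann := annInt_subset_ann (D.collar z hc)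
  have := D.hmap_τ hl (tclamp_mem_Ioo u) hmem
  rwa [P.τ_τ'] at this

/-- On the collar `1 - η < ‖z‖ < 1 + η` the inverse monodromy fixes `e₀ z`. -/
theorem hmap'_e₀_collar (hlam : 1 < lam) (u : ℝ) {z : E2} (hz1 : 1 - D.η < ‖z‖) (hz2 : ‖z‖ < 1 + D.η) :
    D.hmap' (tclamp u) (D.e₀ z) = D.e₀ z := by
  conv_lhs => rw [← D.hmap_e₀_collar hlam u hz1 hz2]
  exact D.hmap'_hmap _ _

/-- `H u z = z` on `{1 - η < ‖z‖}`. -/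
theorem H_eq_self (hlam : 1 < lam) (u : ℝ) {z : E2} (hz : 1 - D.η < ‖z‖) : D.H u z = z := by
  unfold H
  split_ifs with h
  · rw [D.hmap_e₀_collar hlam u hz (by linarith [D.η_pos]), D.e₀'e₀]
  · rfl

/-- `H' u z = z` on `{1 - η < ‖z‖}`. -/
theorem H'_eq_self (hlam : 1 < lam) (u : ℝ) {z : E2} (hz : 1 - D.η < ‖z‖) : D.H' u z = z := by
  unfold H'
  split_ifs with h
  · rw [D.hmap'_e₀_collar hlam u hz (by linarith [D.η_pos]), D.e₀'e₀]
  · rfl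

/-- `H'_u ∘ H_u = id`. -/
theorem H'_H (hlam : 1 < lam) (u : ℝ) (z : E2) : D.H' u (D.H u z) = z := by
  by_cases hz : ‖z‖ < 1
  · obtain ⟨x, hx, hxe⟩ := D.exists_hmap_e₀ hlam u hz
    have hH : D.H u z = x := by rw [H, if_pos hz, hxe, D.e₀'e₀]
    rw [hH, H', if_pos hx, ← hxe, D.hmap'_hmap, D.e₀'e₀]
  · rw [H, if_neg hz, H', if_neg hz]

/-- `H_u ∘ H'_u = id`. -/
theorem H_H' (hlam : 1 < lam) (u : ℝ) (z : E2) : D.H u (D.H' u z) = z := by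
  by_cases hz : ‖z‖ < 1
  · obtain ⟨x, hx, hxe⟩ := D.exists_hmap'_e₀ hlam u hz
    have hH : D.H' u z = x := by rw [H', if_pos hz, hxe, D.e₀'e₀]
    rw [hH, H, if_pos hx, ← hxe, D.hmap_hmap', D.e₀'e₀]
  · rw [H', if_neg hz, H, if_neg hz]

/-- Joint smoothness of `H`. -/
theorem contDiff_H (hlam : 1 < lam) : ContDiff ℝ ∞ (fun q : ℝ × E2 => D.H q.1 q.2) := by
  rw [contDiff_iff_contDiffAt]
  rintro ⟨u, z⟩
  by_cases hz : ‖z‖ < 1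
  · -- the first branch, on the open disc
    have hopen : IsOpen {q : ℝ × E2 | ‖q.2‖ < 1} := isOpen_lt (continuous_norm.comp continuous_snd) continuous_const
    have heq : (fun q : ℝ × E2 => D.H q.1 q.2) =ᶠ[𝓝 (u, z)]
        fun q => D.e₀' (D.hmap (tclamp q.1) (D.e₀ q.2)) := by
      filter_upwards [hopen.mem_nhds (show ‖((u, z) : ℝ × E2).2‖ < 1 from hz)] with q hq
      exact if_pos hq
    refine ContDiffAt.congr_of_eventuallyEq ?_ heq
    have h1 : ContDiffAt ℝ ∞ (fun q : ℝ × E2 => D.hmap (tclamp q.1) (D.e₀ q.2)) (u, z) :=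
      D.contDiff_hmap_uncurry.contDiffAt.comp _ ((contDiff_tclamp.contDiffAt.comp _ contDiffAt_fst).prodMk
        (D.he₀.contDiffAt.comp _ contDiffAt_snd))
    obtain ⟨x, -, hxe⟩ := D.exists_hmap_e₀ hlam u hz
    have h3 := (D.he₀' x).comp_contDiffWithinAt_of_eq (u, z) (h1.contDiffWithinAt (s := Set.univ)) hxe
    rw [contDiffWithinAt_univ] at h3
    exact h3
  · -- on `{1 - η < ‖z‖}` the map is the second projection
    have hz' : 1 - D.η < ‖z‖ := by linarith [D.η_pos, not_lt.1 hz]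
    have hopen : IsOpen {q : ℝ × E2 | 1 - D.η < ‖q.2‖} :=
      isOpen_lt continuous_const (continuous_norm.comp continuous_snd)
    have heq : (fun q : ℝ × E2 => D.H q.1 q.2) =ᶠ[𝓝 (u, z)] fun q => q.2 := by
      filter_upwards [hopen.mem_nhds (show 1 - D.η < ‖((u, z) : ℝ × E2).2‖ from hz')] with q hq
      exact D.H_eq_self hlam q.1 hq
    exact contDiffAt_snd.congr_of_eventuallyEq heq

/-- Joint smoothness of `H'`. -/
theorem contDiff_H' (hlam : 1 < lam) : ContDiff ℝ ∞ (fun q : ℝ × E2 => D.H' q.1 q.2) := by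
  rw [contDiff_iff_contDiffAt]
  rintro ⟨u, z⟩
  by_cases hz : ‖z‖ < 1
  · have hopen : IsOpen {q : ℝ × E2 | ‖q.2‖ < 1} := isOpen_lt (continuous_norm.comp continuous_snd) continuous_const
    have heq : (fun q : ℝ × E2 => D.H' q.1 q.2) =ᶠ[𝓝 (u, z)]
        fun q => D.e₀' (D.hmap' (tclamp q.1) (D.e₀ q.2)) := by
      filter_upwards [hopen.mem_nhds (show ‖((u, z) : ℝ × E2).2‖ < 1 from hz)] with q hq
      exact if_pos hq
    refine ContDiffAt.congr_of_eventuallyEq ?_ heq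
    have h1 : ContDiffAt ℝ ∞ (fun q : ℝ × E2 => D.hmap' (tclamp q.1) (D.e₀ q.2)) (u, z) :=
      D.contDiff_hmap'_uncurry.contDiffAt.comp _ ((contDiff_tclamp.contDiffAt.comp _ contDiffAt_fst).prodMk
        (D.he₀.contDiffAt.comp _ contDiffAt_snd))
    obtain ⟨x, -, hxe⟩ := D.exists_hmap'_e₀ hlam u hz
    have h3 := (D.he₀' x).comp_contDiffWithinAt_of_eq (u, z) (h1.contDiffWithinAt (s := Set.univ)) hxe
    rw [contDiffWithinAt_univ] at h3
    exact h3
  · have hz' : 1 - D.η < ‖z‖ := by linarith [D.η_pos, not_lt.1 hz]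
    have hopen : IsOpen {q : ℝ × E2 | 1 - D.η < ‖q.2‖} :=
      isOpen_lt continuous_const (continuous_norm.comp continuous_snd)
    have heq : (fun q : ℝ × E2 => D.H' q.1 q.2) =ᶠ[𝓝 (u, z)] fun q => q.2 := by
      filter_upwards [hopen.mem_nhds (show 1 - D.η < ‖((u, z) : ℝ × E2).2‖ from hz')] with q hq
      exact D.H'_eq_self hlam q.1 hq
    exact contDiffAt_snd.congr_of_eventuallyEq heq

/-- **Smale in families applied to `H`**: a two-parameter smooth family `K u t` of
diffeomorphisms of the plane, identity for `‖z‖ ≥ 1 - η/2`, from `id` (`t = 0`) to `H u` (`t = 1`). -/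
theorem exists_K (hlam : 1 < lam) : ∃ K Kinv : ℝ → ℝ → E2 → E2,
    (ContDiff ℝ ∞ fun q : ℝ × ℝ × E2 => K q.1 q.2.1 q.2.2) ∧
    (ContDiff ℝ ∞ fun q : ℝ × ℝ × E2 => Kinv q.1 q.2.1 q.2.2) ∧
    (∀ u t z, Kinv u t (K u t z) = z) ∧ (∀ u t z, K u t (Kinv u t z) = z) ∧
    (∀ u z, K u 0 z = z) ∧ (∀ u z, K u 1 z = D.H u z) ∧
    (∀ (u t : ℝ) (z : E2), 1 - D.η / 2 ≤ ‖z‖ → K u t z = z) := by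
  have hR : 0 < 1 - D.η / 2 := by linarith [D.η_le]
  obtain ⟨K, Kinv, hK, hKinv, h1, h2, h0, h1', hsupp, -⟩ :=
    exists_ball_diffeotopy_family_of_linearIsometryEquiv (P := ℝ)
      (Complex.orthonormalBasisOneI.repr.symm : E2 ≃ₗᵢ[ℝ] ℂ) hR
      (D.contDiff_H hlam) (D.contDiff_H' hlam) (D.H'_H hlam) (D.H_H' hlam)
      (fun u z hz => D.H_eq_self hlam u (by linarith [D.η_pos]))
  exact ⟨K, Kinv, hK, hKinv, h1, h2, h0, h1', hsupp⟩

end CD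

end PI

end ClosingData

/-! ### C-iii. The branch family `E_t = Φ_t ∘ e₀ ∘ k_t` and its periodicity -/

section Branch

variable {lam : ℝ} {P : PI lam} {D : PI.CD P}

namespace PI.CD

variable (D) in
/-- The output of Smale's theorem in families for `H`. -/
structure KD where
  /-- the two-parameter diffeotopy `K u t` -/
  K : ℝ → ℝ → E2 → E2
  /-- its inverse -/
  Kinv : ℝ → ℝ → E2 → E2
  /-- `K` is jointly smooth -/
  hK : ContDiff ℝ ∞ fun q : ℝ × ℝ × E2 => K q.1 q.2.1 q.2.2
  /-- `Kinv` is jointly smooth -/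
  hKinv : ContDiff ℝ ∞ fun q : ℝ × ℝ × E2 => Kinv q.1 q.2.1 q.2.2
  /-- `Kinv u t ∘ K u t = id` -/
  KinvK : ∀ u t z, Kinv u t (K u t z) = z
  /-- `K u t ∘ Kinv u t = id` -/
  KKinv : ∀ u t z, K u t (Kinv u t z) = z
  /-- `K u 0 = id` -/
  K0 : ∀ u z, K u 0 z = z
  /-- `K u 1 = H u` -/
  K1 : ∀ u z, K u 1 z = D.H u z
  /-- `K u t` is the identity on `{1 - η/2 ≤ ‖z‖}` -/
  Ksupp : ∀ (u t : ℝ) (z : E2), 1 - D.η / 2 ≤ ‖z‖ → K u t z = z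

variable (D) in
/-- The Smale-in-families data exist. -/
theorem nonempty_KD (hlam : 1 < lam) : Nonempty D.KD := by
  obtain ⟨K, Kinv, h1, h2, h3, h4, h5, h6, h7⟩ := D.exists_K hlam
  exact ⟨⟨K, Kinv, h1, h2, h3, h4, h5, h6, h7⟩⟩

namespace KD

variable (Q : D.KD)

/-- The closing path `k_t = K t (θ₁ t)`. -/
def k (t : ℝ) (z : E2) : E2 := Q.K t (θ₁ t) z

/-- Its inverse. -/
def k' (t : ℝ) (z : E2) : E2 := Q.Kinv t (θ₁ t) z

/-- `(t, z) ↦ k_t z` is smooth. -/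
theorem contDiff_k : ContDiff ℝ ∞ (fun q : ℝ × E2 => Q.k q.1 q.2) :=
  Q.hK.comp (contDiff_fst.prodMk ((contDiff_θ₁.comp contDiff_fst).prodMk contDiff_snd))

/-- `(t, z) ↦ k'_t z` is smooth. -/
theorem contDiff_k' : ContDiff ℝ ∞ (fun q : ℝ × E2 => Q.k' q.1 q.2) :=
  Q.hKinv.comp (contDiff_fst.prodMk ((contDiff_θ₁.comp contDiff_fst).prodMk contDiff_snd))

/-- `k'_t ∘ k_t = id`. -/
theorem k'_k (t : ℝ) (z : E2) : Q.k' t (Q.k t z) = z := Q.KinvK _ _ _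

/-- `k_t ∘ k'_t = id`. -/
theorem k_k' (t : ℝ) (z : E2) : Q.k t (Q.k' t z) = z := Q.KKinv _ _ _

/-- `k_t = id` for `t ≤ 1/4`. -/
theorem k_of_le {t : ℝ} (ht : t ≤ 1 / 4) (z : E2) : Q.k t z = z := by rw [k, θ₁_of_le ht, Q.K0]

/-- `k_t = H_t` for `t ≥ 1/2`. -/
theorem k_of_ge {t : ℝ} (ht : 1 / 2 ≤ t) (z : E2) : Q.k t z = D.H t z := by rw [k, θ₁_of_ge ht, Q.K1]

/-- `k_t` is the identity on `{1 - η/2 ≤ ‖z‖}`. -/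
theorem k_of_norm (t : ℝ) {z : E2} (hz : 1 - D.η / 2 ≤ ‖z‖) : Q.k t z = z := Q.Ksupp _ _ _ hz

/-- `k_t` maps the closed unit disc onto itself (it is the identity near and outside the circle). -/
theorem k_image_closedBall (t : ℝ) : Q.k t '' closedBall (0 : E2) 1 = closedBall 0 1 := by
  have hR : 1 - D.η / 2 < 1 := by linarith [D.η_pos]
  have key : ∀ {f g : E2 → E2}, (∀ z, g (f z) = z) → (∀ z : E2, 1 - D.η / 2 ≤ ‖z‖ → f z = z) →
      (∀ z : E2, 1 - D.η / 2 ≤ ‖z‖ → g z = z) → f '' closedBall (0 : E2) 1 ⊆ closedBall 0 1 := by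
    intro f g hgf hf hg
    rintro _ ⟨z, hz, rfl⟩
    rw [mem_closedBall_zero_iff] at hz ⊢
    by_cases h : 1 - D.η / 2 ≤ ‖z‖
    · rw [hf z h]; exact hz
    · by_contra hc
      have h1 : 1 - D.η / 2 ≤ ‖f z‖ := by linarith [not_le.1 hc]
      have h2 : g (f z) = f z := hg _ h1
      rw [hgf] at h2
      rw [h2] at h
      exact h h1
  have hsupp' : ∀ z : E2, 1 - D.η / 2 ≤ ‖z‖ → Q.k' t z = z := fun z hz => by
    conv_lhs => rw [← Q.k_of_norm t hz]; exact Q.k'_k t z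
  refine Subset.antisymm (key (Q.k'_k t) (fun z hz => Q.k_of_norm t hz) hsupp') fun z hz => ?_
  exact ⟨Q.k' t z, key (Q.k_k' t) hsupp' (fun z hz => Q.k_of_norm t hz) ⟨z, hz, rfl⟩, Q.k_k' t z⟩

end KD

end PI.CD

end Branch

end Planar

end HomothetyCover

end Summit.SmoothPoincare4.SmoothPoincare4.Theorems

end
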